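import Literature.MathematicalPhysics.QuantumChemistry.OnePositivityFromTwoPositivity
import Literature.MathematicalPhysics.QuantumLattice.FreeFermionSpinTwistedTraceFormula
import HarnessLib

/-!
# Ventures/CertifiedQuantumChemistry — Rows/OrbitalRotationEnergy.lean: the energy functional is
# COVARIANT under spin-free orbital rotations (rotated integral tables)

HONEST FRAMING (verbatim): certified bounds for a stated model Hamiltonian in a stated basis; not a
claim about the real molecule beyond that model.

Seat rdm-B, ROWS courtesy file (theorems only; no `def`, no notation); companion of
`Rows/OrbitalRotationCovariance.lean` (feasible sets) and `Rows/OrbitalRotationInvariance.lean`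
(optimal values). A SPIN-FREE LIFT of a one-particle matrix `u : Matrix Λ Λ ℂ` to the spin orbitals
`Orb Λ = Λ ×ₗ Fin 2` is any `U` with `U_{pσ,qτ} = δ_{στ} u_{pq}` (hypothesis `hUu`; no `def` is
introduced, the user supplies `U`, e.g. a reindexed `u ⊗ₖ 1`). For such `U` and ANY pair `(γ, Γ)`:

* `conj_orbital_one_apply`, `conj_orbital_two_apply` — entries of the rotated pair:
  `(UγU†)_{pσ,qτ} = Σ_{ab} u_{pa} ū_{qb} γ_{aσ,bτ}`,
  `((U⊗U)Γ(U⊗U)†)_{(pσ,rτ),(qσ',sτ')} = Σ_{abcd} u_{pa} ū_{qb} u_{rc} ū_{sd} Γ_{(aσ,cτ),(bσ',dτ')}`;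
* **`rdmEnergy_conj_orbital`** — COVARIANCE OF THE ENERGY FUNCTIONAL (Mazziotti 2007 §II.A eqs.
  (4)–(7), `E = Tr(¹K ¹D) + Tr(²K ²D)`: the reduced Hamiltonian transforms contragrediently to the
  reduced density matrices): `E_{h,g}(UγU†, (U⊗U)Γ(U⊗U)†) = E_{h',g'}(γ, Γ)` with the ROTATED
  INTEGRAL TABLES `h'_{ab} = Σ_{pq} u_{pa} ū_{qb} h_{pq}`,
  `g'_{abcd} = Σ_{pqrs} u_{pa} ū_{qb} u_{rc} ū_{sd} g_{pqrs}` — no unitarity needed for this identity;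
  `rdmEnergy_conj_orbital_prod` is the same with the orbital sums bundled over product types, and
  `sum_mul_sum_sum_comm` the Fubini step;
* `spin_sel_of_orbital` (a spin-free lift does not mix spins), **`orbital_mul_conjTranspose`** (the lift
  of a unitary is unitary: `u u† = 1 ⇒ U U† = 1`) — the hypotheses of the two companion files.

Everything is PROVED (0 sorry, standard axioms); no definitions, no named facts; nothing asserts a bound
about any model; no claim node.

References: D. A. Mazziotti, in *Reduced-Density-Matrix Mechanics*, Adv. Chem. Phys. 134 (Wiley 2007)
ch. 3 §II.A eqs. (4)–(7); P. W. Ayers, E. R. Davidson, ibid. ch. 16 §III.F eqs. (56)–(57) (PDF p. 462).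

Tree (REUSED): `rdmEnergy`, `Orb`, `orb` (`VariationalRDMRelaxation`, `QuantumLattice.HubbardWave0`),
`sum_orb_eq_sum_sum` (`QuantumLattice.FreeFermionSpinTwistedTraceFormula`).
Mathlib: `Matrix.kroneckerMap_apply`, `Fintype.sum_prod_type`, `Fintype.sum_equiv`, `Finset.sum_eq_single`,
`Finset.sum_comm`, `Finset.sum_mul_sum`.
-/

noncomputable section

namespace Summit.Ventures.CertifiedQuantumChemistry

open Matrix Finset
open Literature.MathematicalPhysics.QuantumLattice Literature.MathematicalPhysics.QuantumChemistry
open scoped ComplexOrder Kronecker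

variable {Λ : Type*} [LinearOrder Λ] [Fintype Λ]

/-! ## §1 Sums over spin orbitals against a spin-free lift -/



omit [LinearOrder Λ] in
/-- Row contraction against a spin-free lift `U = u ⊗ 1`: `Σ_y U_{pσ,y} f(y) = Σ_a u_{pa} f(aσ)`. -/
theorem sum_orbital_row {U : Matrix (Orb Λ) (Orb Λ) ℂ} {u : Matrix Λ Λ ℂ}
    (hUu : ∀ p q σ τ, U (orb p σ) (orb q τ) = if σ = τ then u p q else 0) (f : Orb Λ → ℂ) (p : Λ)
    (σ : Fin 2) : ∑ y, U (orb p σ) y * f y = ∑ a, u p a * f (orb a σ) := by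
  rw [sum_orb_eq_sum_sum]
  refine Finset.sum_congr rfl fun a _ => ?_
  rw [Finset.sum_eq_single σ]
  · rw [hUu, if_pos rfl]
  · intro σ' _ hne
    rw [hUu, if_neg (Ne.symm hne), zero_mul]
  · exact fun h => (h (Finset.mem_univ σ)).elim

omit [LinearOrder Λ] in
/-- Column contraction against a spin-free lift: `Σ_x f(x) conj(U_{qτ,x}) = Σ_b f(bτ) conj(u_{qb})`. -/
theorem sum_orbital_col {U : Matrix (Orb Λ) (Orb Λ) ℂ} {u : Matrix Λ Λ ℂ}
    (hUu : ∀ p q σ τ, U (orb p σ) (orb q τ) = if σ = τ then u p q else 0) (f : Orb Λ → ℂ) (q : Λ)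
    (τ : Fin 2) : ∑ x, f x * star (U (orb q τ) x) = ∑ b, f (orb b τ) * star (u q b) := by
  rw [sum_orb_eq_sum_sum]
  refine Finset.sum_congr rfl fun b _ => ?_
  rw [Finset.sum_eq_single τ]
  · rw [hUu, if_pos rfl]
  · intro τ' _ hne
    rw [hUu, if_neg (Ne.symm hne), star_zero, mul_zero]
  · exact fun h => (h (Finset.mem_univ τ)).elim

omit [LinearOrder Λ] in
/-- Pair-row contraction against `U ⊗ U`. -/
theorem sum_orbital_row₂ {U : Matrix (Orb Λ) (Orb Λ) ℂ} {u : Matrix Λ Λ ℂ}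
    (hUu : ∀ p q σ τ, U (orb p σ) (orb q τ) = if σ = τ then u p q else 0) (f : Orb Λ × Orb Λ → ℂ)
    (p r : Λ) (σ τ : Fin 2) :
    ∑ Y, (U ⊗ₖ U) (orb p σ, orb r τ) Y * f Y = ∑ a, ∑ c, u p a * u r c * f (orb a σ, orb c τ) := by
  calc ∑ Y, (U ⊗ₖ U) (orb p σ, orb r τ) Y * f Y
      = ∑ y₁, U (orb p σ) y₁ * ∑ y₂, U (orb r τ) y₂ * f (y₁, y₂) := by
        rw [Fintype.sum_prod_type]
        refine Finset.sum_congr rfl fun y₁ _ => ?_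
        rw [Finset.mul_sum]
        refine Finset.sum_congr rfl fun y₂ _ => ?_
        rw [kroneckerMap_apply, mul_assoc]
    _ = ∑ y₁, U (orb p σ) y₁ * ∑ c, u r c * f (y₁, orb c τ) := by
        refine Finset.sum_congr rfl fun y₁ _ => ?_
        rw [sum_orbital_row hUu (fun y₂ => f (y₁, y₂)) r τ]
    _ = ∑ a, u p a * ∑ c, u r c * f (orb a σ, orb c τ) :=
        sum_orbital_row hUu (fun y₁ => ∑ c, u r c * f (y₁, orb c τ)) p σ
    _ = ∑ a, ∑ c, u p a * u r c * f (orb a σ, orb c τ) := by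
        refine Finset.sum_congr rfl fun a _ => ?_
        rw [Finset.mul_sum]
        refine Finset.sum_congr rfl fun c _ => ?_
        rw [mul_assoc]

omit [LinearOrder Λ] in
/-- Pair-column contraction against `(U ⊗ U)†`. -/
theorem sum_orbital_col₂ {U : Matrix (Orb Λ) (Orb Λ) ℂ} {u : Matrix Λ Λ ℂ}
    (hUu : ∀ p q σ τ, U (orb p σ) (orb q τ) = if σ = τ then u p q else 0) (f : Orb Λ × Orb Λ → ℂ)
    (q s : Λ) (σ τ : Fin 2) :
    ∑ X, f X * (U ⊗ₖ U)ᴴ X (orb q σ, orb s τ) =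
      ∑ b, ∑ d, f (orb b σ, orb d τ) * (star (u q b) * star (u s d)) := by
  calc ∑ X, f X * (U ⊗ₖ U)ᴴ X (orb q σ, orb s τ)
      = ∑ x₁, (∑ x₂, f (x₁, x₂) * star (U (orb s τ) x₂)) * star (U (orb q σ) x₁) := by
        rw [Fintype.sum_prod_type]
        refine Finset.sum_congr rfl fun x₁ _ => ?_
        rw [Finset.sum_mul]
        refine Finset.sum_congr rfl fun x₂ _ => ?_
        rw [conjTranspose_apply, kroneckerMap_apply, star_mul', mul_assoc, mul_comm (star (U (orb q σ) x₁))]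
    _ = ∑ x₁, (∑ d, f (x₁, orb d τ) * star (u s d)) * star (U (orb q σ) x₁) := by
        refine Finset.sum_congr rfl fun x₁ _ => ?_
        rw [sum_orbital_col hUu (fun x₂ => f (x₁, x₂)) s τ]
    _ = ∑ b, (∑ d, f (orb b σ, orb d τ) * star (u s d)) * star (u q b) :=
        sum_orbital_col hUu (fun x₁ => ∑ d, f (x₁, orb d τ) * star (u s d)) q σ
    _ = ∑ b, ∑ d, f (orb b σ, orb d τ) * (star (u q b) * star (u s d)) := by
        refine Finset.sum_congr rfl fun b _ => ?_
        rw [Finset.sum_mul]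
        refine Finset.sum_congr rfl fun d _ => ?_
        ring

/-! ## §2 Entries of the rotated pair and covariance of the energy functional -/

omit [LinearOrder Λ] in
/-- **Entries of the rotated 1-matrix**: `(UγU†)_{pσ,qτ} = Σ_{ab} u_{pa} conj(u_{qb}) γ_{aσ,bτ}`. -/
theorem conj_orbital_one_apply {U : Matrix (Orb Λ) (Orb Λ) ℂ} {u : Matrix Λ Λ ℂ}
    (hUu : ∀ p q σ τ, U (orb p σ) (orb q τ) = if σ = τ then u p q else 0)
    (γ : Matrix (Orb Λ) (Orb Λ) ℂ) (p q : Λ) (σ τ : Fin 2) :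
    (U * γ * Uᴴ) (orb p σ) (orb q τ) =
      ∑ y : Λ × Λ, u p y.1 * star (u q y.2) * γ (orb y.1 σ) (orb y.2 τ) := by
  calc (U * γ * Uᴴ) (orb p σ) (orb q τ)
      = ∑ x, (U * γ) (orb p σ) x * star (U (orb q τ) x) := by
        simp only [mul_apply, conjTranspose_apply]
    _ = ∑ b, (U * γ) (orb p σ) (orb b τ) * star (u q b) := sum_orbital_col hUu _ q τ
    _ = ∑ b, (∑ a, u p a * γ (orb a σ) (orb b τ)) * star (u q b) := by
        refine Finset.sum_congr rfl fun b _ => ?_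
        rw [mul_apply, sum_orbital_row hUu (fun y => γ y (orb b τ)) p σ]
    _ = ∑ y : Λ × Λ, u p y.1 * star (u q y.2) * γ (orb y.1 σ) (orb y.2 τ) := by
        rw [Fintype.sum_prod_type, Finset.sum_comm]
        refine Finset.sum_congr rfl fun b _ => ?_
        rw [Finset.sum_mul]
        refine Finset.sum_congr rfl fun a _ => ?_
        dsimp only
        ring

omit [LinearOrder Λ] in
/-- **Entries of the rotated 2-matrix**:
`((U⊗U)Γ(U⊗U)†)_{(pσ,rτ),(qσ',sτ')} = Σ_{abcd} u_{pa} conj(u_{qb}) u_{rc} conj(u_{sd}) Γ_{(aσ,cτ),(bσ',dτ')}`. -/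
theorem conj_orbital_two_apply {U : Matrix (Orb Λ) (Orb Λ) ℂ} {u : Matrix Λ Λ ℂ}
    (hUu : ∀ p q σ τ, U (orb p σ) (orb q τ) = if σ = τ then u p q else 0)
    (Γ : Matrix (Orb Λ × Orb Λ) (Orb Λ × Orb Λ) ℂ) (p q r s : Λ) (σ τ σ' τ' : Fin 2) :
    (U ⊗ₖ U * Γ * (U ⊗ₖ U)ᴴ) (orb p σ, orb r τ) (orb q σ', orb s τ') =
      ∑ y : Λ × Λ × Λ × Λ, u p y.1 * star (u q y.2.1) * u r y.2.2.1 * star (u s y.2.2.2) *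
        Γ (orb y.1 σ, orb y.2.2.1 τ) (orb y.2.1 σ', orb y.2.2.2 τ') := by
  calc (U ⊗ₖ U * Γ * (U ⊗ₖ U)ᴴ) (orb p σ, orb r τ) (orb q σ', orb s τ')
      = ∑ X, (U ⊗ₖ U * Γ) (orb p σ, orb r τ) X * (U ⊗ₖ U)ᴴ X (orb q σ', orb s τ') := by
        rw [mul_apply]
    _ = ∑ b, ∑ d, (U ⊗ₖ U * Γ) (orb p σ, orb r τ) (orb b σ', orb d τ') * (star (u q b) * star (u s d)) :=
        sum_orbital_col₂ hUu _ q s σ' τ'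
    _ = ∑ b, ∑ d, (∑ a, ∑ c, u p a * u r c * Γ (orb a σ, orb c τ) (orb b σ', orb d τ')) *
          (star (u q b) * star (u s d)) := by
        refine Finset.sum_congr rfl fun b _ => Finset.sum_congr rfl fun d _ => ?_
        rw [mul_apply, sum_orbital_row₂ hUu (fun Y => Γ Y (orb b σ', orb d τ')) p r σ τ]
    _ = ∑ a, ∑ b, ∑ c, ∑ d, u p a * star (u q b) * u r c * star (u s d) *
          Γ (orb a σ, orb c τ) (orb b σ', orb d τ') := by
        -- distribute, then reorder the summations (b, d, a, c) → (a, b, c, d)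
        have hdist : ∀ b d : Λ, (∑ a, ∑ c, u p a * u r c * Γ (orb a σ, orb c τ) (orb b σ', orb d τ')) *
            (star (u q b) * star (u s d)) =
            ∑ a, ∑ c, u p a * star (u q b) * u r c * star (u s d) *
              Γ (orb a σ, orb c τ) (orb b σ', orb d τ') := by
          intro b d
          rw [Finset.sum_mul]
          refine Finset.sum_congr rfl fun a _ => ?_
          rw [Finset.sum_mul]
          refine Finset.sum_congr rfl fun c _ => ?_
          ring
        simp only [hdist]
        calc ∑ b, ∑ d, ∑ a, ∑ c, u p a * star (u q b) * u r c * star (u s d) *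
                Γ (orb a σ, orb c τ) (orb b σ', orb d τ')
            = ∑ b, ∑ a, ∑ d, ∑ c, u p a * star (u q b) * u r c * star (u s d) *
                Γ (orb a σ, orb c τ) (orb b σ', orb d τ') :=
              Finset.sum_congr rfl fun _ _ => Finset.sum_comm
          _ = ∑ a, ∑ b, ∑ d, ∑ c, u p a * star (u q b) * u r c * star (u s d) *
                Γ (orb a σ, orb c τ) (orb b σ', orb d τ') := Finset.sum_comm
          _ = ∑ a, ∑ b, ∑ c, ∑ d, u p a * star (u q b) * u r c * star (u s d) *
                Γ (orb a σ, orb c τ) (orb b σ', orb d τ') :=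
              Finset.sum_congr rfl fun _ _ => Finset.sum_congr rfl fun _ _ => Finset.sum_comm
    _ = ∑ y : Λ × Λ × Λ × Λ, u p y.1 * star (u q y.2.1) * u r y.2.2.1 * star (u s y.2.2.2) *
          Γ (orb y.1 σ, orb y.2.2.1 τ) (orb y.2.1 σ', orb y.2.2.2 τ') := by
        simp only [Fintype.sum_prod_type]

omit [LinearOrder Λ] in
/-- The energy functional with its orbital sums bundled over product types. -/
theorem rdmEnergy_eq_sum_prod (h : Λ → Λ → ℂ) (g : Λ → Λ → Λ → Λ → ℂ) (hnuc : ℂ)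
    (γ : Matrix (Orb Λ) (Orb Λ) ℂ) (Γ : Matrix (Orb Λ × Orb Λ) (Orb Λ × Orb Λ) ℂ) :
    rdmEnergy h g hnuc γ Γ =
      ∑ x : Λ × Λ, h x.1 x.2 * ∑ σ : Fin 2, γ (orb x.1 σ) (orb x.2 σ) +
        (1 / 2 : ℂ) * ∑ x : Λ × Λ × Λ × Λ, g x.1 x.2.1 x.2.2.1 x.2.2.2 *
          ∑ s : Fin 2 × Fin 2, Γ (orb x.1 s.1, orb x.2.2.1 s.2) (orb x.2.1 s.1, orb x.2.2.2 s.2) +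
        hnuc := by
  simp only [rdmEnergy, Fintype.sum_prod_type]

/-- A Fubini rearrangement: `Σ_x F_x Σ_s Σ_y G_{xy} K_{ys} = Σ_y (Σ_x G_{xy} F_x) Σ_s K_{ys}`. -/
theorem sum_mul_sum_sum_comm {α β δ : Type*} [Fintype α] [Fintype β] [Fintype δ] (F : α → ℂ)
    (G : α → β → ℂ) (K : β → δ → ℂ) :
    ∑ x, F x * ∑ s, ∑ y, G x y * K y s = ∑ y, (∑ x, G x y * F x) * ∑ s, K y s := by
  calc ∑ x, F x * ∑ s, ∑ y, G x y * K y s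
      = ∑ x, ∑ s, ∑ y, F x * (G x y * K y s) := by simp only [Finset.mul_sum]
    _ = ∑ s, ∑ x, ∑ y, F x * (G x y * K y s) := Finset.sum_comm
    _ = ∑ s, ∑ y, ∑ x, F x * (G x y * K y s) := Finset.sum_congr rfl fun _ _ => Finset.sum_comm
    _ = ∑ y, ∑ s, ∑ x, F x * (G x y * K y s) := Finset.sum_comm
    _ = ∑ y, (∑ x, G x y * F x) * ∑ s, K y s := by
        refine Finset.sum_congr rfl fun y _ => ?_
        rw [Finset.sum_mul_sum, Finset.sum_comm]
        refine Finset.sum_congr rfl fun s _ => Finset.sum_congr rfl fun x _ => ?_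
        ring

omit [LinearOrder Λ] in
/-- **Covariance of the energy functional** (bundled form): evaluating the spin-free functional of
the integral tables `(h, g)` on the rotated pair equals evaluating the functional of the ROTATED
tables `h'_{ab} = Σ_{pq} u_{pa} conj(u_{qb}) h_{pq}`,
`g'_{abcd} = Σ_{pqrs} u_{pa} conj(u_{qb}) u_{rc} conj(u_{sd}) g_{pqrs}` on the original pair. -/
theorem rdmEnergy_conj_orbital_prod {U : Matrix (Orb Λ) (Orb Λ) ℂ} {u : Matrix Λ Λ ℂ}
    (hUu : ∀ p q σ τ, U (orb p σ) (orb q τ) = if σ = τ then u p q else 0) (h : Λ → Λ → ℂ)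
    (g : Λ → Λ → Λ → Λ → ℂ) (hnuc : ℂ) (γ : Matrix (Orb Λ) (Orb Λ) ℂ)
    (Γ : Matrix (Orb Λ × Orb Λ) (Orb Λ × Orb Λ) ℂ) :
    rdmEnergy h g hnuc (U * γ * Uᴴ) (U ⊗ₖ U * Γ * (U ⊗ₖ U)ᴴ) =
      rdmEnergy (fun a b => ∑ x : Λ × Λ, u x.1 a * star (u x.2 b) * h x.1 x.2)
        (fun a b c d => ∑ x : Λ × Λ × Λ × Λ,
          u x.1 a * star (u x.2.1 b) * u x.2.2.1 c * star (u x.2.2.2 d) * g x.1 x.2.1 x.2.2.1 x.2.2.2)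
        hnuc γ Γ := by
  rw [rdmEnergy_eq_sum_prod, rdmEnergy_eq_sum_prod]
  simp only [conj_orbital_one_apply hUu, conj_orbital_two_apply hUu]
  congr 1
  congr 1
  · exact sum_mul_sum_sum_comm _ _ _
  · congr 1
    exact sum_mul_sum_sum_comm _ _ _

omit [LinearOrder Λ] in
/-- **COVARIANCE OF THE ENERGY FUNCTIONAL UNDER A SPIN-FREE ORBITAL ROTATION.** For a spin-free lift
`U_{pσ,qτ} = δ_{στ} u_{pq}` of a one-particle matrix `u` (unitarity not needed here):
`E_{h,g}(UγU†, (U⊗U)Γ(U⊗U)†) = E_{h',g'}(γ, Γ)` with the rotated integral tables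
`h'_{ab} = Σ_{pq} u_{pa} ū_{qb} h_{pq}` and `g'_{abcd} = Σ_{pqrs} u_{pa} ū_{qb} u_{rc} ū_{sd} g_{pqrs}` —
the reduced Hamiltonian transforms contragrediently to the reduced density matrices
(Mazziotti 2007 §II.A eqs. (4)–(7): `E = Tr(K D)`). -/
theorem rdmEnergy_conj_orbital {U : Matrix (Orb Λ) (Orb Λ) ℂ} {u : Matrix Λ Λ ℂ}
    (hUu : ∀ p q σ τ, U (orb p σ) (orb q τ) = if σ = τ then u p q else 0) (h : Λ → Λ → ℂ)
    (g : Λ → Λ → Λ → Λ → ℂ) (hnuc : ℂ) (γ : Matrix (Orb Λ) (Orb Λ) ℂ)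
    (Γ : Matrix (Orb Λ × Orb Λ) (Orb Λ × Orb Λ) ℂ) :
    rdmEnergy h g hnuc (U * γ * Uᴴ) (U ⊗ₖ U * Γ * (U ⊗ₖ U)ᴴ) =
      rdmEnergy (fun a b => ∑ p, ∑ q, u p a * star (u q b) * h p q)
        (fun a b c d => ∑ p, ∑ q, ∑ r, ∑ s, u p a * star (u q b) * u r c * star (u s d) * g p q r s)
        hnuc γ Γ := by
  rw [rdmEnergy_conj_orbital_prod hUu]
  simp only [Fintype.sum_prod_type]

/-! ## §3 The spin-free lift of a unitary -/

omit [LinearOrder Λ] [Fintype Λ] in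
/-- A spin-free lift does not mix spins. -/
theorem spin_sel_of_orbital {U : Matrix (Orb Λ) (Orb Λ) ℂ} {u : Matrix Λ Λ ℂ}
    (hUu : ∀ p q σ τ, U (orb p σ) (orb q τ) = if σ = τ then u p q else 0) (i k : Orb Λ)
    (hik : (ofLex i).2 ≠ (ofLex k).2) : U i k = 0 := by
  obtain ⟨⟨p, σ⟩, rfl⟩ := toLex.surjective i
  obtain ⟨⟨q, τ⟩, rfl⟩ := toLex.surjective k
  change U (orb p σ) (orb q τ) = 0
  rw [hUu, if_neg]
  exact hik

/-- **The spin-free lift of a unitary one-particle matrix is unitary** (`u u† = 1 ⇒ U U† = 1`). -/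
theorem orbital_mul_conjTranspose {U : Matrix (Orb Λ) (Orb Λ) ℂ} {u : Matrix Λ Λ ℂ}
    (hUu : ∀ p q σ τ, U (orb p σ) (orb q τ) = if σ = τ then u p q else 0) (hu : u * uᴴ = 1) :
    U * Uᴴ = 1 := by
  ext i k
  obtain ⟨⟨p, σ⟩, rfl⟩ := toLex.surjective i
  obtain ⟨⟨q, τ⟩, rfl⟩ := toLex.surjective k
  change (U * Uᴴ) (orb p σ) (orb q τ) = (1 : Matrix (Orb Λ) (Orb Λ) ℂ) (orb p σ) (orb q τ)
  have huq : (u * uᴴ) p q = ∑ b, u p b * star (u q b) := by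
    simp only [mul_apply, conjTranspose_apply]
  calc (U * Uᴴ) (orb p σ) (orb q τ) = ∑ x, U (orb p σ) x * star (U (orb q τ) x) := by
        simp only [mul_apply, conjTranspose_apply]
    _ = ∑ b, U (orb p σ) (orb b τ) * star (u q b) := sum_orbital_col hUu _ q τ
    _ = ∑ b, (if σ = τ then u p b else 0) * star (u q b) := by simp only [hUu]
    _ = if σ = τ then (u * uᴴ) p q else 0 := by
        split_ifs with hστ
        · rw [huq]
        · simp only [zero_mul, Finset.sum_const_zero]
    _ = (1 : Matrix (Orb Λ) (Orb Λ) ℂ) (orb p σ) (orb q τ) := by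
        rw [hu, one_apply, one_apply]
        simp only [EmbeddingLike.apply_eq_iff_eq, Prod.mk.injEq]
        by_cases hpq : p = q <;> by_cases hστ : σ = τ <;> simp [hpq, hστ]


end Summit.Ventures.CertifiedQuantumChemistry

end
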